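import Mathlib.RingTheory.KrullDimension.Polynomial
import Mathlib.RingTheory.KrullDimension.Field
import Mathlib.Algebra.MvPolynomial.Funext
import Summits.Schanuel.Schanuel.Theorems.ZilberEacComplexPunctureBM
import Summits.Schanuel.Schanuel.Theorems.ZilberEacComplexCornerBM
import HarnessLib

/-!
# EC with arbitrary polynomial right-hand sides over a negative graph hypersurface

Graphs `W = {y = A(x)}` of polynomial maps `A : ℂˢ → ℂˢ` (no `Aⱼ ≡ 0`) are Brownawell–Masser
varieties — irreducible Zariski closed of dimension `s` with dominant additive projection
(`isIrreducibleClosed_polyGraph`, `zariskiDim_polyGraph`, `hasDominantAddProjection_polyGraph`;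
coordinate ring `ℂ[x, y]/ker φ_A ≅ ℂ[x]`). Feeding them to Theorem A
(`exists_expPoint_punctureBM_avoiding`, `ZilberEacComplexPunctureBM.lean`) gives
`exists_solution_polyRHS` (and the corner version `exists_solution_polyRHS_corner` via Theorem B,
`ZilberEacComplexCornerBM.lean`): for `g` with a lattice direction of negative leading real part and ANY
polynomials `Aⱼ ≠ 0`, `Fⱼ`, the system `e^{xⱼ} = Aⱼ(x) + e^{g(x)} Fⱼ(e^{g(x)}, x)` (`j ≤ s`) has a
Zariski-dense set of solutions — the coupled-polynomial generalization of
`exists_expPoint_punctureDecoupling` (affine decoupled `Aⱼ`), inside the open range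
`dim π₁(V) = n - 1` of Zilber's Exponential-Algebraic Closedness (Mantova–Masser, PLMS 2024, p. 5).
HONEST FRAMING: a modest new case of EAC; no bearing on Schanuel's conjecture.
-/

noncomputable section

open Complex MvPolynomial Metric Set Filter Topology
open Literature.NumberTheory.Transcendental

set_option linter.dupNamespace false

namespace Summit.Schanuel.Schanuel.Theorems
/-! ### Graphs of polynomial maps are Brownawell–Masser varieties -/

section GraphFibre

variable {s : ℕ}

/-- The graph `{(x, A(x))} ⊆ ℂˢ × ℂˢ` of a polynomial map `A : ℂˢ → ℂˢ`, as a set of points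
`z : Fin s ⊕ Fin s → ℂ`. [folklore] -/
def polyGraph (A : Fin s → MvPolynomial (Fin s) ℂ) : Set (Fin s ⊕ Fin s → ℂ) :=
  {z | ∀ j, z (Sum.inr j) = eval (fun i => z (Sum.inl i)) (A j)}

/-- A point of the graph is `(x, A(x))` with `x` its additive part. [folklore] -/
theorem eq_elim_of_mem_polyGraph {A : Fin s → MvPolynomial (Fin s) ℂ} {z : Fin s ⊕ Fin s → ℂ}
    (hz : z ∈ polyGraph A) :
    z = Sum.elim (fun i => z (Sum.inl i)) (fun j => eval (fun i => z (Sum.inl i)) (A j)) := by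
  funext k
  rcases k with i | j
  · rfl
  · exact hz j

/-- `(x, A(x))` lies on the graph. [folklore] -/
theorem elim_mem_polyGraph (A : Fin s → MvPolynomial (Fin s) ℂ) (x : Fin s → ℂ) :
    (Sum.elim x (fun j => eval x (A j)) : Fin s ⊕ Fin s → ℂ) ∈ polyGraph A := fun _ => rfl

/-- The substitution `φ_A : ℂ[x, y] → ℂ[x]`, `xᵢ ↦ xᵢ`, `yⱼ ↦ Aⱼ(x)` (an algebra map). [folklore] -/
def graphSubst (A : Fin s → MvPolynomial (Fin s) ℂ) :
    MvPolynomial (Fin s ⊕ Fin s) ℂ →ₐ[ℂ] MvPolynomial (Fin s) ℂ :=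
  aeval (Sum.elim X A)

/-- Evaluation at a graph point `(x, A(x))` factors through the substitution `φ_A`. [folklore] -/
theorem aeval_elim_eq_eval_graphSubst (A : Fin s → MvPolynomial (Fin s) ℂ) (x : Fin s → ℂ)
    (f : MvPolynomial (Fin s ⊕ Fin s) ℂ) :
    aeval (Sum.elim x (fun j => eval x (A j))) f = eval x (graphSubst A f) := by
  have h : (aeval (Sum.elim x fun j => eval x (A j)) : MvPolynomial (Fin s ⊕ Fin s) ℂ →ₐ[ℂ] ℂ) =
      (aeval x).comp (graphSubst A) := by
    refine MvPolynomial.algHom_ext fun k => ?_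
    rcases k with i | j
    · simp [graphSubst]
    · simp [graphSubst]
  rw [h, AlgHom.comp_apply]
  rfl

/-- The graph is Zariski closed: the zero locus of the `yⱼ - Aⱼ(x)`. [folklore] -/
theorem isZariskiClosed_polyGraph (A : Fin s → MvPolynomial (Fin s) ℂ) :
    IsZariskiClosed ℂ (polyGraph A) := by
  refine ⟨Ideal.span (Set.range fun j => X (Sum.inr j) - rename Sum.inl (A j)), ?_⟩
  ext z
  rw [zeroLocus_span]
  simp only [Set.mem_setOf_eq, Set.forall_mem_range, map_sub, aeval_X, aeval_rename, sub_eq_zero]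
  rfl

/-- The vanishing ideal of the graph is the kernel of the substitution `φ_A : yⱼ ↦ Aⱼ(x)`
(`⊆` by `MvPolynomial.funext` over the infinite field `ℂ`). [folklore] -/
theorem vanishingIdeal_polyGraph (A : Fin s → MvPolynomial (Fin s) ℂ) :
    vanishingIdeal ℂ (polyGraph A) = RingHom.ker (graphSubst A) := by
  ext f
  rw [mem_vanishingIdeal_iff, RingHom.mem_ker]
  constructor
  · intro hf
    refine MvPolynomial.funext fun x => ?_
    rw [map_zero, ← aeval_elim_eq_eval_graphSubst]
    exact hf _ (elim_mem_polyGraph A x)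
  · intro hf z hz
    rw [eq_elim_of_mem_polyGraph hz, aeval_elim_eq_eval_graphSubst, hf, map_zero]

/-- The substitution `φ_A` is surjective (`φ_A(p(x)) = p(x)`). [folklore] -/
theorem graphSubst_surjective (A : Fin s → MvPolynomial (Fin s) ℂ) :
    Function.Surjective (graphSubst A) := by
  intro p
  refine ⟨rename Sum.inl p, ?_⟩
  rw [graphSubst, aeval_rename]
  have : (Sum.elim X A : Fin s ⊕ Fin s → MvPolynomial (Fin s) ℂ) ∘ Sum.inl = X := by
    funext i; rfl
  rw [this, aeval_X_left, AlgHom.id_apply]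

/-- **The graph of a polynomial map is irreducible Zariski closed.** [folklore] -/
theorem isIrreducibleClosed_polyGraph (A : Fin s → MvPolynomial (Fin s) ℂ) :
    IsIrreducibleClosed ℂ (polyGraph A) := by
  refine ⟨isZariskiClosed_polyGraph A, ?_⟩
  rw [vanishingIdeal_polyGraph]
  exact RingHom.ker_isPrime _

/-- **The graph of a polynomial map `ℂˢ → ℂˢ` has Zariski dimension `s`** (its coordinate ring is
`ℂ[x, y]/ker φ_A ≅ ℂ[x]`). [folklore] -/
theorem zariskiDim_polyGraph (A : Fin s → MvPolynomial (Fin s) ℂ) :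
    zariskiDim ℂ (polyGraph A) = s := by
  unfold zariskiDim
  rw [ringKrullDim_eq_of_ringEquiv (Ideal.quotEquivOfEq (vanishingIdeal_polyGraph A)),
    ringKrullDim_eq_of_ringEquiv
      (Ideal.quotientKerAlgEquivOfSurjective (graphSubst_surjective A)).toRingEquiv,
    MvPolynomial.ringKrullDim_of_isNoetherianRing, ringKrullDim_eq_zero_of_field, zero_add,
    Nat.card_eq_fintype_card, Fintype.card_fin]

/-- The torus part of the graph (no `Aⱼ ≡ 0`) is nonempty. [folklore] -/
theorem polyGraph_inter_torusLocus_nonempty {A : Fin s → MvPolynomial (Fin s) ℂ}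
    (hA : ∀ j, A j ≠ 0) : (polyGraph A ∩ torusLocus ℂ s).Nonempty := by
  classical
  have hprod : (∏ j, A j) ≠ 0 := Finset.prod_ne_zero_iff.mpr fun j _ => hA j
  obtain ⟨x, hx⟩ : ∃ x : Fin s → ℂ, eval x (∏ j, A j) ≠ 0 := by
    by_contra h
    push Not at h
    exact hprod (MvPolynomial.funext fun x => by rw [h x, map_zero])
  refine ⟨Sum.elim x fun j => eval x (A j), elim_mem_polyGraph A x, fun j => ?_⟩
  rw [map_prod] at hx
  simpa using Finset.prod_ne_zero_iff.mp hx j (Finset.mem_univ j)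

/-- **The graph of a polynomial map projects dominantly to `ℂˢ`** (even its torus part, if no
`Aⱼ ≡ 0`): a polynomial vanishing on `{x : ∏ Aⱼ(x) ≠ 0}` vanishes identically. [folklore] -/
theorem hasDominantAddProjection_polyGraph {A : Fin s → MvPolynomial (Fin s) ℂ} (hA : ∀ j, A j ≠ 0) :
    HasDominantAddProjection ℂ (polyGraph A ∩ torusLocus ℂ s) := by
  classical
  intro p hp
  have hprod : (∏ j, A j) ≠ 0 := Finset.prod_ne_zero_iff.mpr fun j _ => hA j
  have hzero : p * ∏ j, A j = 0 := by
    refine MvPolynomial.funext fun x => ?_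
    rw [map_mul, map_zero]
    by_cases hx : eval x (∏ j, A j) = 0
    · rw [hx, mul_zero]
    · have hz : (Sum.elim x fun j => eval x (A j) : Fin s ⊕ Fin s → ℂ) ∈
          polyGraph A ∩ torusLocus ℂ s := by
        refine ⟨elim_mem_polyGraph A x, fun j => ?_⟩
        rw [map_prod] at hx
        simpa using Finset.prod_ne_zero_iff.mp hx j (Finset.mem_univ j)
      have := hp _ hz
      rw [show projAdd (Sum.elim x fun j => eval x (A j)) = x from rfl] at this
      rw [this, zero_mul]
  exact (mul_eq_zero.mp hzero).resolve_right hprod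

/-- **EC with polynomial right-hand sides over a negative graph hypersurface** (Theorem A with the
graph fibre `W = {y = A(x)}`): for `g ∈ ℂ[x₁..xₛ]` of degree `≥ 1` with a lattice direction `q₀`,
`Re g_D(2πi q₀) < 0`, arbitrary polynomials `Aⱼ ∈ ℂ[x₁..xₛ] ∖ {0}` and `Fⱼ ∈ ℂ[u, x₁..xₛ]`, the
system `exp (xⱼ) = Aⱼ(x) + e^{g(x)} Fⱼ(e^{g(x)}, x)` (`j ≤ s`) has solutions `x ∈ ℂˢ`, Zariski dense
in `ℂˢ` (avoiding any given hypersurface `h = 0`). Equivalently the `(s+1)`-fold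
`{xₙ = g(x'), yⱼ = Aⱼ(x') + yₙ Fⱼ(yₙ, x')}` meets the graph of `exp`. This generalizes
`exists_expPoint_punctureDecoupling` (affine, decoupled `Aⱼ`) to arbitrary coupled polynomial
`Aⱼ`. [cite: MantovaMasser2023, §1 p.5 (the open case dim π(V) = 2 in ℂ³×ℂˣ³)] -/
theorem exists_solution_polyRHS {s : ℕ} (g : MvPolynomial (Fin s) ℂ) (hD : 0 < g.totalDegree)
    (q₀ : Fin s → ℤ)
    (hq₀ : (eval (fun j => 2 * Real.pi * I * (q₀ j : ℂ))
      (homogeneousComponent g.totalDegree g)).re < 0)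
    (A : Fin s → MvPolynomial (Fin s) ℂ) (hA : ∀ j, A j ≠ 0)
    (F : Fin s → MvPolynomial (Fin (s + 1)) ℂ) (h : MvPolynomial (Fin s) ℂ) (hh : h ≠ 0) :
    ∃ x : Fin s → ℂ, eval x h ≠ 0 ∧ ∀ j, exp (x j) = eval x (A j) +
        exp (eval x g) * eval (Fin.cons (exp (eval x g)) x) (F j) := by
  obtain ⟨x, hxh, hx⟩ := exists_expPoint_punctureBM_avoiding g hD q₀ hq₀ (polyGraph A)
    (isIrreducibleClosed_polyGraph A) (zariskiDim_polyGraph A) (hasDominantAddProjection_polyGraph hA)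
    F h hh
  refine ⟨x, hxh, fun j => ?_⟩
  have := hx j
  simp only [Sum.elim_inr, Sum.elim_inl] at this
  rw [← this]
  ring

/-- **Corner version** (Theorem B with the graph fibre `W = {y' = A(x')}`): for a polynomial map
`G : ℂˢ → ℂᵗ` (degrees `≥ 1`) with a common lattice direction of negative leading real parts,
arbitrary `Aⱼ ∈ ℂ[x'] ∖ {0}` and `Fⱼₖ ∈ ℂ[u, x']`, the system
`exp (xⱼ) = Aⱼ(x) + Σₖ e^{Gₖ(x)} Fⱼₖ(e^{G(x)}, x)` (`j ≤ s`) has a Zariski-dense set of solutions in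
`ℂˢ`; equivalently the `(t+s)`-fold `{x'' = G(x'), yⱼ = Aⱼ(x') + Σₖ uₖ Fⱼₖ(u, x')}` (additive
projection of dimension `s`) meets the graph of `exp`. [cite: MantovaMasser2023, §1 p.5 (the open range dim π(V) < n)] -/
theorem exists_solution_polyRHS_corner {s t : ℕ} (G : Fin t → MvPolynomial (Fin s) ℂ)
    (hD : ∀ k, 0 < (G k).totalDegree) (q₀ : Fin s → ℤ)
    (hq₀ : ∀ k, (eval (fun j => 2 * Real.pi * I * (q₀ j : ℂ))
      (homogeneousComponent (G k).totalDegree (G k))).re < 0)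
    (A : Fin s → MvPolynomial (Fin s) ℂ) (hA : ∀ j, A j ≠ 0)
    (F : Fin s → Fin t → MvPolynomial (Fin (t + s)) ℂ) (h : MvPolynomial (Fin s) ℂ) (hh : h ≠ 0) :
    ∃ x : Fin s → ℂ, eval x h ≠ 0 ∧ ∀ j, exp (x j) = eval x (A j) +
        ∑ k, exp (eval x (G k)) * eval (Fin.append (fun k => exp (eval x (G k))) x) (F j k) := by
  obtain ⟨x, hxh, hx⟩ := exists_expPoint_cornerBM_avoiding G hD q₀ hq₀ (polyGraph A)
    (isIrreducibleClosed_polyGraph A) (zariskiDim_polyGraph A) (hasDominantAddProjection_polyGraph hA)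
    F h hh
  refine ⟨x, hxh, fun j => ?_⟩
  have := hx j
  simp only [Sum.elim_inr, Sum.elim_inl] at this
  rw [← this]
  ring

end GraphFibre

end Summit.Schanuel.Schanuel.Theorems
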